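import Summits.NavierStokesRegularity.NavierStokesRegularity.Theorems.HubbleDynamoHelicityFluxIdentityTools
import Summits.NavierStokesRegularity.NavierStokesRegularity.Theorems.HubbleDynamoHelicityFluxIdentityEvolution
import Literature.Analysis.FluidPDE.Superhelicity
import HarnessLib

/-!
# The helicity-flux identity of a Leray profile, V: the `s`-periodic (DSS) case
# (route `HubbleDynamo`, item `HelicityFluxIdentity`, stmt-NavierStokesRegularity-2060)

All results proved; no definitions, no named facts. A `λ`-DSS Type-I blow-up is, in Leray's
similarity variables, an `s`-periodic classical solution of the backward Leray system
`∂ₛU + ½U + ½(y·∇)U + (U·∇)U + ∇P = νΔU`, `div U = 0` (the tree's `IsBackwardLeraySolutionOn`,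
period `T = 2 log λ` in the KNSS/Chae–Wolf normalisation). For such a solution in the Type-I decay
class uniformly in `s` (`|U| ≤ C/(1+|y|)`, `|∇U| ≤ C/(1+|y|)²`, `|∇curl U| ≤ C/(1+|y|)³`,
`|P| ≤ C/(1+|y|)`) the period-integrated helicity balance passes to the limit `R → ∞`:

* `hubbleHelicity_periodic_flux_tendsto` / `hubbleDynamo_helicityFluxIdentity_periodic` —

    `½ ∫₀ᵀ ∫ (y·∇cutoff R)(y) ⟪U, Ω⟫(s,y) dy ds ⟶ 2ν ∫₀ᵀ superhelicity (U s) ds`  (`R → ∞`):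

  over a period, the helicity exported to infinity by the Hubble flow `½y` equals the Ohmic
  destruction of helicity. The `∂ₛ⟪U,Ω⟫`-term of the balance
  (`hubbleHelicityEvo_truncated`) integrates to zero over a period on each fixed cut-off
  (`hubbleHelicityEvo_integral_Ioo_timeDeriv` and periodicity) — the conditionally convergent
  `∫ ⟪U,Ω⟫` itself is never needed —, the three small flux terms are dominated uniformly in
  `(s, R)` (`hubbleHelicity_flux_error_bound`), and dominated convergence on `(0,T)` does the
  rest. The steady case is part III (`hubbleDynamo_helicityFluxIdentity`, general `a`).

References: as in parts I–IV; Chae–Wolf, arXiv:1610.09464 (Thm 1.1: decay of DSS profiles;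
§4: the backward Leray system); Bradshaw–Tsai 2017 (time-periodic Leray systems).
-/

noncomputable section

-- D-0017: `<Problem> = <Summit>` by design; the lakefile turns this linter off for `Summits`.
set_option linter.dupNamespace false

open MeasureTheory Set Function Filter Topology InnerProductSpace
open scoped RealInnerProductSpace Laplacian ContDiff

namespace Summit.NavierStokesRegularity.NavierStokesRegularity.Theorems

open Literature.Analysis.FluidPDE

/-! ### Two pieces of bookkeeping -/

/-- **Continuity in `s` of cut-off integrals.** If `f : ℝ × ℝ³ → ℝ` is jointly continuous and
`f(s, y) = 0` for `|y| > 2R` (`R > 0`), then `s ↦ ∫ f(s, y) dy` is continuous (Mathlib's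
`continuousOn_integral_of_compact_support` on the ball of radius `2R`). -/
theorem hubbleHelicityPer_continuous_integral {f : ℝ → EuclideanSpace ℝ (Fin 3) → ℝ}
    (hf : Continuous (uncurry f)) (R : ℝ) (hfs : ∀ s y, 2 * R < ‖y‖ → f s y = 0) :
    Continuous fun s => ∫ y, f s y := by
  rw [← continuousOn_univ]
  refine continuousOn_integral_of_compact_support (k := Metric.closedBall 0 (2 * R))
    (isCompact_closedBall 0 (2 * R)) hf.continuousOn fun p x _ hx => hfs p x ?_
  rw [Metric.mem_closedBall, dist_zero_right, not_le] at hx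
  exact hx

/-- **Dominated convergence over a period** with a constant dominating function: if the
`F R : ℝ → ℝ` are eventually continuous and eventually bounded by `B` on `ℝ`, and `F R s → f s`
for every `s`, then `∫_{(0,T)} F R → ∫_{(0,T)} f`. -/
theorem hubbleHelicityPer_tendsto_setIntegral {F : ℝ → ℝ → ℝ} {f : ℝ → ℝ} {T B : ℝ}
    (hmeas : ∀ᶠ R in atTop, Continuous (F R)) (hbound : ∀ᶠ R in atTop, ∀ s, ‖F R s‖ ≤ B)
    (hlim : ∀ s, Tendsto (fun R => F R s) atTop (𝓝 (f s))) :
    Tendsto (fun R => ∫ s in Ioo 0 T, F R s) atTop (𝓝 (∫ s in Ioo 0 T, f s)) := by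
  refine tendsto_integral_filter_of_dominated_convergence (fun _ => B) ?_ ?_ ?_ ?_
  · exact hmeas.mono fun R hR => hR.aestronglyMeasurable
  · exact hbound.mono fun R hR => Eventually.of_forall hR
  · exact integrableOn_const (by rw [Real.volume_Ioo]; exact ENNReal.ofReal_ne_top)
  · exact Eventually.of_forall hlim


/-! ### The period-integrated identity -/

/-- **The helicity-flux identity over a period (limit form).** For a classical solution of the
backward Leray system `∂ₛU + ½U + ½(y·∇)U + (U·∇)U + ∇P = νΔU`, `div U = 0` on `ℝ × ℝ³`,
`s`-periodic with period `T > 0`, in the Type-I decay class uniformly in `s`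
(`|U| ≤ C/(1+|y|)`, `|∇U| ≤ C/(1+|y|)²`, `|∇curl U| ≤ C/(1+|y|)³`, `|P| ≤ C/(1+|y|)`):

  `½ ∫_{(0,T)} ∫ (y·∇cutoff R)(y) ⟪U(s), curl U(s)⟫(y) dy ds ⟶ 2ν ∫_{(0,T)} ∫ ⟪Ω(s), curl Ω(s)⟫ dy ds`

as `R → ∞` (`Ω = curl U`). -/
theorem hubbleHelicity_periodic_flux_tendsto {ν T : ℝ} (hT : 0 < T)
    {U : ℝ → EuclideanSpace ℝ (Fin 3) → EuclideanSpace ℝ (Fin 3)}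
    {P : ℝ → EuclideanSpace ℝ (Fin 3) → ℝ} (h : IsBackwardLeraySolutionOn univ ν U P)
    (hper : ∀ s, U (s + T) = U s) {C : ℝ}
    (hC : ∀ s y, ‖U s y‖ ≤ C / (1 + ‖y‖) ∧ ‖fderiv ℝ (U s) y‖ ≤ C / (1 + ‖y‖) ^ 2 ∧
      ‖fderiv ℝ (curl (U s)) y‖ ≤ C / (1 + ‖y‖) ^ 3)
    (hPC : ∀ s y, |P s y| ≤ C / (1 + ‖y‖)) :
    Tendsto (fun R : ℝ => (1 / 2 : ℝ) *
        ∫ s in Ioo 0 T, ∫ y, fderiv ℝ (cutoff R) y y * ⟪U s y, curl (U s) y⟫) atTop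
      (𝓝 (2 * ν * ∫ s in Ioo 0 T, ∫ y, ⟪curl (U s) y, curl (curl (U s)) y⟫)) := by
  -- joint smoothness and continuity
  have hSu : UniqueDiffOn ℝ (univ : Set ℝ) := uniqueDiffOn_univ
  have hcl : (univ : Set ℝ) ⊆ closure (interior univ) := by simp
  have hw : IsSmoothSpaceTimeOn univ U := h.smooth_velocity
  have hΩ : IsSmoothSpaceTimeOn univ (vorticity U) := hw.isSmoothSpaceTimeOn_vorticity hSu
  have hΞ : IsSmoothSpaceTimeOn univ (vorticity (vorticity U)) := hΩ.isSmoothSpaceTimeOn_vorticity hSu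
  have hPs : IsSmoothSpaceTimeOn univ P := h.smooth_pressure
  have hdU : IsSmoothSpaceTimeOn univ (timeDerivWithin univ U) := hw.timeDerivWithin hSu
  have hdΩ : IsSmoothSpaceTimeOn univ (timeDerivWithin univ (vorticity U)) := hΩ.timeDerivWithin hSu
  have jc : ∀ {F : Type} [NormedAddCommGroup F] [NormedSpace ℝ F]
      {w : ℝ → EuclideanSpace ℝ (Fin 3) → F}, IsSmoothSpaceTimeOn univ w →
      Continuous fun z : ℝ × EuclideanSpace ℝ (Fin 3) => w z.1 z.2 := by
    intro F _ _ w hw'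
    have := hw'.continuousOn
    rw [univ_prod_univ, continuousOn_univ] at this
    exact this
  have cU := jc hw
  have cΩ := jc hΩ
  have cΞ := jc hΞ
  have cP := jc hPs
  have cdU := jc hdU
  have cdΩ := jc hdΩ
  simp only [vorticity_apply] at cΩ cΞ cdΩ
  have cH : Continuous fun z : ℝ × EuclideanSpace ℝ (Fin 3) => ⟪U z.1 z.2, curl (U z.1) z.2⟫ :=
    cU.inner cΩ
  have cQ : Continuous fun z : ℝ × EuclideanSpace ℝ (Fin 3) => ‖U z.1 z.2‖ ^ 2 / 2 - P z.1 z.2 :=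
    ((cU.norm.pow 2).div_const 2).sub cP
  have cG1 : Continuous fun z : ℝ × EuclideanSpace ℝ (Fin 3) =>
      (‖U z.1 z.2‖ ^ 2 / 2 - P z.1 z.2) • curl (U z.1) z.2 := cQ.smul cΩ
  have cG2 : Continuous fun z : ℝ × EuclideanSpace ℝ (Fin 3) =>
      ⟪U z.1 z.2, curl (U z.1) z.2⟫ • U z.1 z.2 := cH.smul cU
  have cG4 : Continuous fun z : ℝ × EuclideanSpace ℝ (Fin 3) =>
      cross (curl (curl (U z.1)) z.2) (U z.1 z.2) := crossCLM.continuous₂.comp (cΞ.prodMk cU)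
  have cT : Continuous fun z : ℝ × EuclideanSpace ℝ (Fin 3) =>
      ⟪timeDerivWithin univ U z.1 z.2, curl (U z.1) z.2⟫
        + ⟪U z.1 z.2, timeDerivWithin univ (vorticity U) z.1 z.2⟫ :=
    (cdU.inner cΩ).add (cU.inner cdΩ)
  -- slices
  have hUs : ∀ s, ContDiff ℝ ∞ (U s) := fun s => hw.contDiff_slice (mem_univ s)
  have hU3 : ∀ s, ContDiff ℝ 3 (U s) := fun s => (hUs s).of_le (by norm_cast)
  have hU1 : ∀ s, ContDiff ℝ 1 (U s) := fun s => (hUs s).of_le (by norm_cast)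
  have hΞ1 : ∀ s, ContDiff ℝ 1 (curl (curl (U s))) := fun s => by
    have hΩ2 : ContDiff ℝ 2 (curl (U s)) := contDiff_curl (n := 2) (by exact_mod_cast hU3 s)
    exact contDiff_curl (n := 1) (by exact_mod_cast hΩ2)
  have cPs : ∀ s, Continuous (P s) := fun s => (hPs.contDiff_slice (mem_univ s)).continuous
  have cΩs : ∀ s, Continuous (curl (U s)) := fun s =>
    (contDiff_curl (n := 1) (by exact_mod_cast (hUs s).of_le (by norm_cast) : ContDiff ℝ 2 (U s))).continuous
  have cHs : ∀ s, Continuous fun y => ⟪U s y, curl (U s) y⟫ := fun s =>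
    (hU1 s).continuous.inner (cΩs s)
  have cQs : ∀ s, Continuous fun y => ‖U s y‖ ^ 2 / 2 - P s y := fun s =>
    (((hU1 s).continuous.norm.pow 2).div_const 2).sub (cPs s)
  have cG1s : ∀ s, Continuous fun y => (‖U s y‖ ^ 2 / 2 - P s y) • curl (U s) y :=
    fun s => (cQs s).smul (cΩs s)
  have cG2s : ∀ s, Continuous fun y => ⟪U s y, curl (U s) y⟫ • U s y :=
    fun s => (cHs s).smul (hU1 s).continuous
  have cG4s : ∀ s, Continuous fun y => cross (curl (curl (U s)) y) (U s y) :=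
    fun s => (hubbleHelicity_contDiff_cross (hΞ1 s) (hU1 s)).continuous
  -- constants
  obtain ⟨K₀, hK₀0, hK₀⟩ := exists_norm_fderiv_cutoff_le (E := EuclideanSpace ℝ (Fin 3))
  set κ : ℝ := ‖curlCLM‖ with hκ
  set I₄ : ℝ := ∫ y : EuclideanSpace ℝ (Fin 3), ((1 + ‖y‖) ^ 4)⁻¹ with hI₄
  have hr : ∀ y : EuclideanSpace ℝ (Fin 3), 1 ≤ 1 + ‖y‖ := fun y => by linarith [norm_nonneg y]
  have hC0 : 0 ≤ C := by
    have h0 := (hC 0 0).1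
    rw [norm_zero, add_zero, div_one] at h0
    exact (norm_nonneg _).trans h0
  -- the cut-off and its gradient vanish off the ball of radius `2R`
  have zc : ∀ {R : ℝ}, 0 < R → ∀ y : EuclideanSpace ℝ (Fin 3), 2 * R < ‖y‖ → cutoff R y = 0 :=
    fun hR y hy => cutoff_eq_zero hR hy.le
  have zd : ∀ {R : ℝ}, 0 < R → ∀ y : EuclideanSpace ℝ (Fin 3), 2 * R < ‖y‖ →
      fderiv ℝ (cutoff R) y = 0 := fun hR y hy => hubbleHelicity_fderiv_cutoff_eq_zero_of_gt hR hy
  have ccut : ∀ R, Continuous (cutoff (E := EuclideanSpace ℝ (Fin 3)) R) := fun R =>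
    (contDiff_cutoff (n := 1) R).continuous
  have cdcut : ∀ R, Continuous (fderiv ℝ (cutoff (E := EuclideanSpace ℝ (Fin 3)) R)) := fun R =>
    (contDiff_cutoff (n := 1) R).continuous_fderiv one_ne_zero
  -- continuity in `s` of the five cut-off integrals (for `R > 0`)
  have cA : ∀ {R : ℝ}, 0 < R → Continuous fun s =>
      ∫ y, cutoff R y * ⟪curl (U s) y, curl (curl (U s)) y⟫ := fun {R} hR =>
    hubbleHelicityPer_continuous_integral (f := fun s y => cutoff R y * ⟪curl (U s) y, curl (curl (U s)) y⟫)
      (((ccut R).comp continuous_snd).mul (cΩ.inner cΞ)) R fun s y hy => by simp [zc hR y hy]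
  have cD : ∀ {R : ℝ}, 0 < R → Continuous fun s =>
      ∫ y, cutoff R y * (⟪timeDerivWithin univ U s y, curl (U s) y⟫
        + ⟪U s y, timeDerivWithin univ (vorticity U) s y⟫) := fun {R} hR =>
    hubbleHelicityPer_continuous_integral (f := fun s y => cutoff R y *
        (⟪timeDerivWithin univ U s y, curl (U s) y⟫ + ⟪U s y, timeDerivWithin univ (vorticity U) s y⟫))
      (((ccut R).comp continuous_snd).mul cT) R fun s y hy => by simp [zc hR y hy]
  have cI1 : ∀ {R : ℝ}, 0 < R → Continuous fun s =>
      ∫ y, fderiv ℝ (cutoff R) y ((‖U s y‖ ^ 2 / 2 - P s y) • curl (U s) y) := fun {R} hR =>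
    hubbleHelicityPer_continuous_integral
      (f := fun s y => fderiv ℝ (cutoff R) y ((‖U s y‖ ^ 2 / 2 - P s y) • curl (U s) y))
      (((cdcut R).comp continuous_snd).clm_apply cG1) R fun s y hy => by simp [zd hR y hy]
  have cI2 : ∀ {R : ℝ}, 0 < R → Continuous fun s =>
      ∫ y, fderiv ℝ (cutoff R) y (⟪U s y, curl (U s) y⟫ • U s y) := fun {R} hR =>
    hubbleHelicityPer_continuous_integral
      (f := fun s y => fderiv ℝ (cutoff R) y (⟪U s y, curl (U s) y⟫ • U s y))
      (((cdcut R).comp continuous_snd).clm_apply cG2) R fun s y hy => by simp [zd hR y hy]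
  have cI4 : ∀ {R : ℝ}, 0 < R → Continuous fun s =>
      ∫ y, fderiv ℝ (cutoff R) y (cross (curl (curl (U s)) y) (U s y)) := fun {R} hR =>
    hubbleHelicityPer_continuous_integral
      (f := fun s y => fderiv ℝ (cutoff R) y (cross (curl (curl (U s)) y) (U s y)))
      (((cdcut R).comp continuous_snd).clm_apply cG4) R fun s y hy => by simp [zd hR y hy]
  have cM : ∀ {R : ℝ}, 0 < R → Continuous fun s =>
      ∫ y, fderiv ℝ (cutoff R) y y * ⟪U s y, curl (U s) y⟫ := fun {R} hR =>
    hubbleHelicityPer_continuous_integral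
      (f := fun s y => fderiv ℝ (cutoff R) y y * ⟪U s y, curl (U s) y⟫)
      ((((cdcut R).comp continuous_snd).clm_apply continuous_snd).mul cH) R
      fun s y hy => by simp [zd hR y hy]
  -- integrability on the period
  have iIoo : ∀ {g : ℝ → ℝ}, Continuous g → IntegrableOn g (Ioo 0 T) := fun hg =>
    (hg.integrableOn_Icc (a := 0) (b := T)).mono_set Ioo_subset_Icc_self
  -- the `∂ₛ`-term integrates to zero over a period
  have hD0 : ∀ {R : ℝ}, 0 < R → ∫ s in Ioo 0 T, ∫ y, cutoff R y *
      (⟪timeDerivWithin univ U s y, curl (U s) y⟫ + ⟪U s y, timeDerivWithin univ (vorticity U) s y⟫)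
      = 0 := by
    intro R hR
    rw [hubbleHelicityEvo_integral_Ioo_timeDeriv h (ccut R) (hasCompactSupport_cutoff hR) hT.le]
    have hTU : U T = U 0 := by simpa using hper 0
    rw [hTU, sub_self]
  -- the period-integrated truncated identity, for `R > 0`
  have hid : ∀ {R : ℝ}, 0 < R →
      (1 / 2 : ℝ) * ∫ s in Ioo 0 T, ∫ y, fderiv ℝ (cutoff R) y y * ⟪U s y, curl (U s) y⟫ =
      2 * ν * (∫ s in Ioo 0 T, ∫ y, cutoff R y * ⟪curl (U s) y, curl (curl (U s)) y⟫)
        + (∫ s in Ioo 0 T, ∫ y, fderiv ℝ (cutoff R) y ((‖U s y‖ ^ 2 / 2 - P s y) • curl (U s) y))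
        - (∫ s in Ioo 0 T, ∫ y, fderiv ℝ (cutoff R) y (⟪U s y, curl (U s) y⟫ • U s y))
        - ν * ∫ s in Ioo 0 T, ∫ y, fderiv ℝ (cutoff R) y (cross (curl (curl (U s)) y) (U s y)) := by
    intro R hR
    have e1 : ∫ s in Ioo 0 T, (1 / 2 : ℝ) * ∫ y, fderiv ℝ (cutoff R) y y * ⟪U s y, curl (U s) y⟫ =
        ∫ s in Ioo 0 T, ((((2 * ν * ∫ y, cutoff R y * ⟪curl (U s) y, curl (curl (U s)) y⟫)
          + ∫ y, cutoff R y * (⟪timeDerivWithin univ U s y, curl (U s) y⟫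
              + ⟪U s y, timeDerivWithin univ (vorticity U) s y⟫))
          + ∫ y, fderiv ℝ (cutoff R) y ((‖U s y‖ ^ 2 / 2 - P s y) • curl (U s) y))
          - ∫ y, fderiv ℝ (cutoff R) y (⟪U s y, curl (U s) y⟫ • U s y))
          - ν * ∫ y, fderiv ℝ (cutoff R) y (cross (curl (curl (U s)) y) (U s y)) :=
      setIntegral_congr_fun measurableSet_Ioo fun s _ =>
        hubbleHelicityEvo_truncated h hSu hcl (mem_univ s) (contDiff_cutoff (n := 1) R)
          (hasCompactSupport_cutoff hR)
    rw [← integral_const_mul, e1, integral_sub, integral_sub, integral_add, integral_add,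
      integral_const_mul, integral_const_mul, hD0 hR]
    · ring
    · exact (iIoo (cA hR)).const_mul _
    · exact iIoo (cD hR)
    · exact ((iIoo (cA hR)).const_mul _).add (iIoo (cD hR))
    · exact iIoo (cI1 hR)
    · exact (((iIoo (cA hR)).const_mul _).add (iIoo (cD hR))).add (iIoo (cI1 hR))
    · exact iIoo (cI2 hR)
    · exact ((((iIoo (cA hR)).const_mul _).add (iIoo (cD hR))).add (iIoo (cI1 hR))).sub
        (iIoo (cI2 hR))
    · exact (iIoo (cI4 hR)).const_mul _
  -- uniform bounds
  have bA : ∀ R s, ‖∫ y, cutoff R y * ⟪curl (U s) y, curl (curl (U s)) y⟫‖ ≤ (κ * C) * (κ * C) * I₄ := by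
    intro R s
    rw [hI₄, ← integral_const_mul]
    refine (norm_integral_le_integral_norm _).trans (integral_mono_of_nonneg
      (Eventually.of_forall fun y => norm_nonneg _)
      (hubbleHelicity_integrable_decay_four.const_mul _) (Eventually.of_forall fun y => ?_))
    change ‖cutoff R y * ⟪curl (U s) y, curl (curl (U s)) y⟫‖ ≤ (κ * C) * (κ * C) * ((1 + ‖y‖) ^ 4)⁻¹
    rw [norm_mul, Real.norm_eq_abs]
    calc |cutoff R y| * ‖⟪curl (U s) y, curl (curl (U s)) y⟫‖
        ≤ 1 * ((κ * C) * (κ * C) * ((1 + ‖y‖) ^ 5)⁻¹) :=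
          mul_le_mul (abs_cutoff_le_one R y) (hubbleHelicity_decay_bounds (hC s) (hPC s) y).1
            (norm_nonneg _) zero_le_one
      _ ≤ (κ * C) * (κ * C) * ((1 + ‖y‖) ^ 4)⁻¹ := by
          rw [one_mul]
          exact hubbleHelicity_decay_mono (by positivity) (hr y) (by norm_num)
  -- the limits of the four period integrals
  have LA : Tendsto (fun R => ∫ s in Ioo 0 T, ∫ y, cutoff R y * ⟪curl (U s) y, curl (curl (U s)) y⟫)
      atTop (𝓝 (∫ s in Ioo 0 T, ∫ y, ⟪curl (U s) y, curl (curl (U s)) y⟫)) :=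
    hubbleHelicityPer_tendsto_setIntegral
      ((eventually_gt_atTop (0 : ℝ)).mono fun R hR => cA hR)
      (Eventually.of_forall fun R s => bA R s)
      fun s => hubbleHelicity_tendsto_integral_cutoff_mul (hubbleHelicity_integrable_ohmic (hU3 s) (hC s))
  have LI1 : Tendsto (fun R => ∫ s in Ioo 0 T,
      ∫ y, fderiv ℝ (cutoff R) y ((‖U s y‖ ^ 2 / 2 - P s y) • curl (U s) y)) atTop
      (𝓝 (∫ _ in Ioo 0 T, (0 : ℝ))) :=
    hubbleHelicityPer_tendsto_setIntegral
      ((eventually_gt_atTop (0 : ℝ)).mono fun R hR => cI1 hR)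
      ((eventually_ge_atTop (1 : ℝ)).mono fun R hR s =>
        hubbleHelicity_flux_error_bound hK₀ (fun y => (hubbleHelicity_decay_bounds (hC s) (hPC s) y).2.1) hR)
      fun s => hubbleHelicity_flux_error_tendsto (cG1s s)
        fun y => (hubbleHelicity_decay_bounds (hC s) (hPC s) y).2.1
  have LI2 : Tendsto (fun R => ∫ s in Ioo 0 T,
      ∫ y, fderiv ℝ (cutoff R) y (⟪U s y, curl (U s) y⟫ • U s y)) atTop (𝓝 (∫ _ in Ioo 0 T, (0 : ℝ))) :=
    hubbleHelicityPer_tendsto_setIntegral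
      ((eventually_gt_atTop (0 : ℝ)).mono fun R hR => cI2 hR)
      ((eventually_ge_atTop (1 : ℝ)).mono fun R hR s =>
        hubbleHelicity_flux_error_bound hK₀ (fun y => (hubbleHelicity_decay_bounds (hC s) (hPC s) y).2.2.1) hR)
      fun s => hubbleHelicity_flux_error_tendsto (cG2s s)
        fun y => (hubbleHelicity_decay_bounds (hC s) (hPC s) y).2.2.1
  have LI4 : Tendsto (fun R => ∫ s in Ioo 0 T,
      ∫ y, fderiv ℝ (cutoff R) y (cross (curl (curl (U s)) y) (U s y))) atTop
      (𝓝 (∫ _ in Ioo 0 T, (0 : ℝ))) :=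
    hubbleHelicityPer_tendsto_setIntegral
      ((eventually_gt_atTop (0 : ℝ)).mono fun R hR => cI4 hR)
      ((eventually_ge_atTop (1 : ℝ)).mono fun R hR s =>
        hubbleHelicity_flux_error_bound hK₀ (fun y => (hubbleHelicity_decay_bounds (hC s) (hPC s) y).2.2.2) hR)
      fun s => hubbleHelicity_flux_error_tendsto (cG4s s)
        fun y => (hubbleHelicity_decay_bounds (hC s) (hPC s) y).2.2.2
  simp only [integral_zero] at LI1 LI2 LI4
  -- assemble
  have lim := (((LA.const_mul (2 * ν)).add LI1).sub LI2).sub (LI4.const_mul ν)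
  simp only [mul_zero, add_zero, sub_zero] at lim
  refine lim.congr' ?_
  filter_upwards [eventually_gt_atTop (0 : ℝ)] with R hR
  exact (hid hR).symm

/-- **Helicity-flux identity of an `s`-periodic Leray profile (DSS case)** (route `HubbleDynamo`,
item `HelicityFluxIdentity`, periodic case; candidate signature). For a classical `T`-periodic
solution of the backward Leray system `∂ₛU + ½U + ½(y·∇)U + (U·∇)U + ∇P = νΔU`, `div U = 0` on
`ℝ × ℝ³` with Type-I tails uniformly in `s`, over one period the helicity exported to infinity by
the Hubble flow `½y` equals the Ohmic destruction of helicity: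
`½ ∫_{(0,T)} ∫ (y·∇cutoff R) ⟪U, curl U⟫ dy ds ⟶ 2ν ∫_{(0,T)} superhelicity (U s) ds` as `R → ∞`. -/
theorem hubbleDynamo_helicityFluxIdentity_periodic (ν T : ℝ) (hT : 0 < T)
    (U : ℝ → EuclideanSpace ℝ (Fin 3) → EuclideanSpace ℝ (Fin 3))
    (P : ℝ → EuclideanSpace ℝ (Fin 3) → ℝ) (hsol : IsBackwardLeraySolutionOn univ ν U P)
    (hper : ∀ s, U (s + T) = U s)
    (hdec : ∃ C : ℝ, ∀ s y, ‖U s y‖ ≤ C / (1 + ‖y‖) ∧ ‖fderiv ℝ (U s) y‖ ≤ C / (1 + ‖y‖) ^ 2 ∧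
      ‖fderiv ℝ (curl (U s)) y‖ ≤ C / (1 + ‖y‖) ^ 3 ∧ |P s y| ≤ C / (1 + ‖y‖)) :
    Tendsto (fun R : ℝ => (1 / 2 : ℝ) *
        ∫ s in Ioo 0 T, ∫ y, fderiv ℝ (cutoff R) y y * ⟪U s y, curl (U s) y⟫) atTop
      (𝓝 (2 * ν * ∫ s in Ioo 0 T, superhelicity (U s))) := by
  obtain ⟨C, hC⟩ := hdec
  simp only [superhelicity_eq_integral_inner]
  exact hubbleHelicity_periodic_flux_tendsto hT hsol hper
    (fun s y => ⟨(hC s y).1, (hC s y).2.1, (hC s y).2.2.1⟩) fun s y => (hC s y).2.2.2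

end Summit.NavierStokesRegularity.NavierStokesRegularity.Theorems

end
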